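import Summits.CriticalPhenomena.PercolationContinuityZ3.Theorems.PercNearOneGluingNoHeavyLowerTailSahiTriangleStaircase
import Summits.CriticalPhenomena.PercolationContinuityZ3.Theorems.PercNearOneGluingNoHeavyLowerTailSahiTriangleStaircaseTwoAtoms
import Mathlib.Tactic.Linarith
import Mathlib.Tactic.Ring
import HarnessLib

/-!
# `NoHeavyLowerTail` (crux stmt-CriticalPhenomena-4575), P2 — the triangle class with a GENERAL two-step staircase member

Memo SAHI-ROUTE.md §4.23 (seat `prim-masterthm-p2`, gen 7; `--supports stmt-CriticalPhenomena-4575`).  No `sorry`, no named facts.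
Companion of `…SahiTriangleStaircase` (the special case `ψ₁ ≡ 1`) and of `…SahiTriangleStaircaseTwoAtoms` (the atom algebra).

SETTING (class T): finite distributive lattices `α, β, γ` with FKG probability weights `wA, wB, wC`; `g : γ → β → ℝ`, `h : α → β → ℝ`
nonnegative coordinatewise monotone; the third member is the general TWO-STEP STAIRCASE
`f(c,a) = φ₁(c)ψ₁(a) + (φ₂(c) − φ₁(c))ψ₂(a)`, `0 ≤ φ₁ ≤ φ₂ ≤ 1` monotone on `γ`, `0 ≤ ψ₂ ≤ ψ₁ ≤ 1` monotone on `α`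
(for events: `f = 1_{(U₁×V₁) ∪ (U₂×V₂)}`, `U₁ ⊆ U₂`, `V₁ ⊇ V₂` increasing — neither cross-super- nor cross-submodular).

CONTENT.
* `atomsOf` — the 19 β-atoms of the member; `sahiE_three_eq_E3` — the exact β-REDUCTION `E_3(f,g,h) = Atoms.E3 (atomsOf …)`;
  `bounds_atomsOf` — the atoms satisfy `Atoms.Bounds` (FKG on `γ`, `α` blockwise; FKG on `β`; signs).
* `sahiE_three_nonneg_of_staircaseTwo_of_min_le` — **`E_3 ≥ 0` whenever `min(Eφ₁, Eψ₂) ≤ Eφ₁Eψ₁ + Eφ₂Eψ₂`** (`Eφ₁, Eψ₂ > 0`); covers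
  `Eφ₂, Eψ₁ ≥ 1/2`, `φ₂ ≡ 1` (OR-type) and `ψ₁ ≡ 1` (`…SahiTriangleStaircase`).
* `sahiE_three_nonneg_of_staircaseTwo_of_cov_le` — `E_3 ≥ 0` whenever `Cov(φ₁,g) ≤ Cov(φ₂,g)` or `Cov(ψ₂,h) ≤ Cov(ψ₁,h)` (no mass condition).
NOT HERE: the remaining parameter region `Eφ₁Eψ₁ + Eφ₂Eψ₂ < min(Eφ₁, Eψ₂)` (pointwise LP certificates exist; a closed form is open,
SAHI-ROUTE §4.23(e)), and the `K`-step staircase (CONJECTURE STAIR).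
-/

noncomputable section

open scoped Classical

namespace Summit.CriticalPhenomena.PercolationContinuityZ3.Theorems

namespace SahiTriangleStaircaseTwo


section Member

open Finset
open Literature.Combinatorics.Sahi2008
open SahiChainTriangle (ex_prod3 drop_a drop_b drop_c)
open SahiTriangleSupermodular (fkg_sum sum3_bca)
open SahiTriangleStaircase (PC mB dB nB PC_nonneg PC_mono PC_le_one mB_nonneg mB_mono dB_nonneg dB_mono nB_nonneg
  slackC_nonneg)

variable {α β γ : Type} [Fintype α] [Fintype β] [Fintype γ]
  (wA : α → ℝ) (wB : β → ℝ) (wC : γ → ℝ) (φ₁ φ₂ : γ → ℝ) (ψ₁ ψ₂ : α → ℝ) (g : γ → β → ℝ) (h : α → β → ℝ)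

/-- The atoms of the two-step member: `P_i = E φ_i`, `Q_j = E ψ_j`, `m = mB wC φ₁ g`, `d = dB wC φ₁ φ₂ g`, `n = nB wC φ₂ g`,
`u = mB wA ψ₂ h`, `e = dB wA ψ₂ ψ₁ h`, `t = nB wA ψ₁ h`, and their `wB`-moments. [this work] -/
def atomsOf : Atoms where
  P1 := PC wC φ₁
  P2 := PC wC φ₂
  Q1 := PC wA ψ₁
  Q2 := PC wA ψ₂
  Smu := ∑ b, wB b * (mB wC φ₁ g b * mB wA ψ₂ h b)
  Sme := ∑ b, wB b * (mB wC φ₁ g b * dB wA ψ₂ ψ₁ h b)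
  Smt := ∑ b, wB b * (mB wC φ₁ g b * nB wA ψ₁ h b)
  Sdu := ∑ b, wB b * (dB wC φ₁ φ₂ g b * mB wA ψ₂ h b)
  Sde := ∑ b, wB b * (dB wC φ₁ φ₂ g b * dB wA ψ₂ ψ₁ h b)
  Sdt := ∑ b, wB b * (dB wC φ₁ φ₂ g b * nB wA ψ₁ h b)
  Snu := ∑ b, wB b * (nB wC φ₂ g b * mB wA ψ₂ h b)
  Sne := ∑ b, wB b * (nB wC φ₂ g b * dB wA ψ₂ ψ₁ h b)
  Snt := ∑ b, wB b * (nB wC φ₂ g b * nB wA ψ₁ h b)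
  Sm := ∑ b, wB b * mB wC φ₁ g b
  Sd := ∑ b, wB b * dB wC φ₁ φ₂ g b
  Sn := ∑ b, wB b * nB wC φ₂ g b
  Su := ∑ b, wB b * mB wA ψ₂ h b
  Se := ∑ b, wB b * dB wA ψ₂ ψ₁ h b
  St := ∑ b, wB b * nB wA ψ₁ h b

/-- **β-REDUCTION.** Sahi's `E_3` of the two-step triangle equals `Atoms.E3` of its atoms (exact identity; probability weights). [this work] -/
theorem sahiE_three_eq_E3 (hA1 : ∑ a, wA a = 1) (hB1 : ∑ b, wB b = 1) (hC1 : ∑ c, wC c = 1) :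
    sahiE (fun p : α × β × γ => wA p.1 * wB p.2.1 * wC p.2.2) 3
        ![fun p => φ₁ p.2.2 * ψ₁ p.1 + (φ₂ p.2.2 - φ₁ p.2.2) * ψ₂ p.1, fun p => g p.2.2 p.2.1, fun p => h p.1 p.2.1]
      = (atomsOf wA wB wC φ₁ φ₂ ψ₁ ψ₂ g h).E3 := by
  rw [sahiE_three]
  simp only [ex_prod3, Pi.mul_apply]
  have gsplit : ∀ b, (∑ c, wC c * g c b) = mB wC φ₁ g b + dB wC φ₁ φ₂ g b + nB wC φ₂ g b := fun b => by
    simp only [mB, dB, nB, ← sum_add_distrib]; exact sum_congr rfl fun c _ => by ring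
  have g1 : ∀ b, (∑ c, wC c * (φ₁ c * g c b)) = mB wC φ₁ g b := fun b => rfl
  have gd : ∀ b, (∑ c, wC c * ((φ₂ c - φ₁ c) * g c b)) = dB wC φ₁ φ₂ g b := fun b => rfl
  have hsplit : ∀ b, (∑ a, wA a * h a b) = mB wA ψ₂ h b + dB wA ψ₂ ψ₁ h b + nB wA ψ₁ h b := fun b => by
    simp only [mB, dB, nB, ← sum_add_distrib]; exact sum_congr rfl fun a _ => by ring
  have h2 : ∀ b, (∑ a, wA a * (ψ₂ a * h a b)) = mB wA ψ₂ h b := fun b => rfl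
  have h1 : ∀ b, (∑ a, wA a * (ψ₁ a * h a b)) = mB wA ψ₂ h b + dB wA ψ₂ ψ₁ h b := fun b => by
    simp only [mB, dB, ← sum_add_distrib]; exact sum_congr rfl fun a _ => by ring
  -- the seven expectations
  have eF : (∑ a, ∑ b, ∑ c, wA a * wB b * wC c * (φ₁ c * ψ₁ a + (φ₂ c - φ₁ c) * ψ₂ a)) =
      PC wC φ₁ * PC wA ψ₁ + (PC wC φ₂ - PC wC φ₁) * PC wA ψ₂ := by
    rw [drop_b wA wB wC hB1 fun a c => φ₁ c * ψ₁ a + (φ₂ c - φ₁ c) * ψ₂ a]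
    have : (∑ a, ∑ c, wA a * wC c * (φ₁ c * ψ₁ a + (φ₂ c - φ₁ c) * ψ₂ a)) =
        (∑ a, ∑ c, (wA a * ψ₁ a) * (wC c * φ₁ c))
          + ((∑ a, ∑ c, (wA a * ψ₂ a) * (wC c * φ₂ c)) - ∑ a, ∑ c, (wA a * ψ₂ a) * (wC c * φ₁ c)) := by
      rw [← sum_sub_distrib, ← sum_add_distrib]
      refine sum_congr rfl fun a _ => ?_
      rw [← sum_sub_distrib, ← sum_add_distrib]
      exact sum_congr rfl fun c _ => by ring
    rw [this, ← sum_mul_sum, ← sum_mul_sum, ← sum_mul_sum]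
    simp only [PC]; ring
  have eG : (∑ a, ∑ b, ∑ c, wA a * wB b * wC c * g c b) =
      (∑ b, wB b * mB wC φ₁ g b) + (∑ b, wB b * dB wC φ₁ φ₂ g b) + ∑ b, wB b * nB wC φ₂ g b := by
    rw [drop_a wA wB wC hA1 fun b c => g c b, ← sum_add_distrib, ← sum_add_distrib]
    refine sum_congr rfl fun b _ => ?_
    rw [← mul_add, ← mul_add, ← gsplit b, mul_sum]
    exact sum_congr rfl fun c _ => by ring
  have eH : (∑ a, ∑ b, ∑ c, wA a * wB b * wC c * h a b) =
      (∑ b, wB b * mB wA ψ₂ h b) + (∑ b, wB b * dB wA ψ₂ ψ₁ h b) + ∑ b, wB b * nB wA ψ₁ h b := by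
    rw [drop_c wA wB wC hC1 h, sum_comm, ← sum_add_distrib, ← sum_add_distrib]
    refine sum_congr rfl fun b _ => ?_
    rw [← mul_add, ← mul_add, ← hsplit b, mul_sum]
    exact sum_congr rfl fun a _ => by ring
  have eGH : (∑ a, ∑ b, ∑ c, wA a * wB b * wC c * (g c b * h a b)) =
      ∑ b, wB b * ((mB wC φ₁ g b + dB wC φ₁ φ₂ g b + nB wC φ₂ g b)
        * (mB wA ψ₂ h b + dB wA ψ₂ ψ₁ h b + nB wA ψ₁ h b)) := by
    rw [sum3_bca]
    refine sum_congr rfl fun b _ => ?_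
    rw [← gsplit b, ← hsplit b, sum_mul_sum, mul_sum]
    refine sum_congr rfl fun c _ => ?_
    rw [mul_sum]
    exact sum_congr rfl fun a _ => by ring
  have eFGH : (∑ a, ∑ b, ∑ c, wA a * wB b * wC c * ((φ₁ c * ψ₁ a + (φ₂ c - φ₁ c) * ψ₂ a) * g c b * h a b)) =
      ∑ b, wB b * (mB wC φ₁ g b * (mB wA ψ₂ h b + dB wA ψ₂ ψ₁ h b) + dB wC φ₁ φ₂ g b * mB wA ψ₂ h b) := by
    rw [sum3_bca]
    refine sum_congr rfl fun b _ => ?_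
    rw [← g1 b, ← gd b, ← h1 b, ← h2 b, sum_mul_sum, sum_mul_sum, ← sum_add_distrib, mul_sum]
    refine sum_congr rfl fun c _ => ?_
    rw [← sum_add_distrib, mul_sum]
    exact sum_congr rfl fun a _ => by ring
  have eFH : (∑ a, ∑ b, ∑ c, wA a * wB b * wC c * ((φ₁ c * ψ₁ a + (φ₂ c - φ₁ c) * ψ₂ a) * h a b)) =
      ∑ b, wB b * (PC wC φ₁ * (mB wA ψ₂ h b + dB wA ψ₂ ψ₁ h b) + (PC wC φ₂ - PC wC φ₁) * mB wA ψ₂ h b) := by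
    rw [sum3_bca]
    refine sum_congr rfl fun b _ => ?_
    have : (∑ c, ∑ a, wA a * wB b * wC c * ((φ₁ c * ψ₁ a + (φ₂ c - φ₁ c) * ψ₂ a) * h a b)) =
        wB b * ((∑ c, wC c * φ₁ c) * (∑ a, wA a * (ψ₁ a * h a b))
          + ((∑ c, wC c * φ₂ c) - ∑ c, wC c * φ₁ c) * ∑ a, wA a * (ψ₂ a * h a b)) := by
      rw [← sum_sub_distrib, sum_mul_sum, sum_mul_sum, ← sum_add_distrib, mul_sum]
      refine sum_congr rfl fun c _ => ?_
      rw [← sum_add_distrib, mul_sum]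
      exact sum_congr rfl fun a _ => by ring
    rw [this, h1 b, h2 b]; rfl
  have eFG : (∑ a, ∑ b, ∑ c, wA a * wB b * wC c * ((φ₁ c * ψ₁ a + (φ₂ c - φ₁ c) * ψ₂ a) * g c b)) =
      ∑ b, wB b * (PC wA ψ₁ * mB wC φ₁ g b + PC wA ψ₂ * dB wC φ₁ φ₂ g b) := by
    rw [sum3_bca]
    refine sum_congr rfl fun b _ => ?_
    have : (∑ c, ∑ a, wA a * wB b * wC c * ((φ₁ c * ψ₁ a + (φ₂ c - φ₁ c) * ψ₂ a) * g c b)) =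
        wB b * ((∑ c, wC c * (φ₁ c * g c b)) * (∑ a, wA a * ψ₁ a)
          + (∑ c, wC c * ((φ₂ c - φ₁ c) * g c b)) * ∑ a, wA a * ψ₂ a) := by
      rw [sum_mul_sum, sum_mul_sum, ← sum_add_distrib, mul_sum]
      refine sum_congr rfl fun c _ => ?_
      rw [← sum_add_distrib, mul_sum]
      exact sum_congr rfl fun a _ => by ring
    rw [this, g1 b, gd b]
    simp only [PC]; ring
  rw [eF, eG, eH, eGH, eFGH, eFH, eFG]
  have sGH : (∑ b, wB b * ((mB wC φ₁ g b + dB wC φ₁ φ₂ g b + nB wC φ₂ g b)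
        * (mB wA ψ₂ h b + dB wA ψ₂ ψ₁ h b + nB wA ψ₁ h b))) =
      (∑ b, wB b * (mB wC φ₁ g b * mB wA ψ₂ h b)) + (∑ b, wB b * (mB wC φ₁ g b * dB wA ψ₂ ψ₁ h b))
      + (∑ b, wB b * (mB wC φ₁ g b * nB wA ψ₁ h b)) + (∑ b, wB b * (dB wC φ₁ φ₂ g b * mB wA ψ₂ h b))
      + (∑ b, wB b * (dB wC φ₁ φ₂ g b * dB wA ψ₂ ψ₁ h b)) + (∑ b, wB b * (dB wC φ₁ φ₂ g b * nB wA ψ₁ h b))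
      + (∑ b, wB b * (nB wC φ₂ g b * mB wA ψ₂ h b)) + (∑ b, wB b * (nB wC φ₂ g b * dB wA ψ₂ ψ₁ h b))
      + (∑ b, wB b * (nB wC φ₂ g b * nB wA ψ₁ h b)) := by
    symm; simp only [← sum_add_distrib]; exact sum_congr rfl fun b _ => by ring
  have sFGH : (∑ b, wB b * (mB wC φ₁ g b * (mB wA ψ₂ h b + dB wA ψ₂ ψ₁ h b) + dB wC φ₁ φ₂ g b * mB wA ψ₂ h b)) =
      (∑ b, wB b * (mB wC φ₁ g b * mB wA ψ₂ h b)) + (∑ b, wB b * (mB wC φ₁ g b * dB wA ψ₂ ψ₁ h b))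
      + (∑ b, wB b * (dB wC φ₁ φ₂ g b * mB wA ψ₂ h b)) := by
    symm; simp only [← sum_add_distrib]; exact sum_congr rfl fun b _ => by ring
  have sFH : (∑ b, wB b * (PC wC φ₁ * (mB wA ψ₂ h b + dB wA ψ₂ ψ₁ h b) + (PC wC φ₂ - PC wC φ₁) * mB wA ψ₂ h b)) =
      PC wC φ₁ * ((∑ b, wB b * mB wA ψ₂ h b) + ∑ b, wB b * dB wA ψ₂ ψ₁ h b)
      + (PC wC φ₂ - PC wC φ₁) * ∑ b, wB b * mB wA ψ₂ h b := by
    symm; rw [mul_add, mul_sum, mul_sum, mul_sum, ← sum_add_distrib, ← sum_add_distrib]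
    exact sum_congr rfl fun b _ => by ring
  have sFG : (∑ b, wB b * (PC wA ψ₁ * mB wC φ₁ g b + PC wA ψ₂ * dB wC φ₁ φ₂ g b)) =
      PC wA ψ₁ * (∑ b, wB b * mB wC φ₁ g b) + PC wA ψ₂ * ∑ b, wB b * dB wC φ₁ φ₂ g b := by
    symm; rw [mul_sum, mul_sum, ← sum_add_distrib]
    exact sum_congr rfl fun b _ => by ring
  rw [sGH, sFGH, sFH, sFG]
  simp only [Atoms.E3, atomsOf]
  ring


variable {wA wB wC φ₁ φ₂ ψ₁ ψ₂ g h}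

omit [Fintype β] in
/-- `n_b` (and `t_b`) is monotone in `b`. [this work] -/
theorem nB_mono' {δ : Type} [Fintype δ] [Preorder β] {w : δ → ℝ} {φ : δ → ℝ} {k : δ → β → ℝ} (hw : ∀ i, 0 ≤ w i)
    (hφ1 : ∀ i, φ i ≤ 1) (hkb : ∀ i, Monotone (k i)) : Monotone (nB w φ k) := fun _ _ hbb =>
  sum_le_sum fun i _ => mul_le_mul_of_nonneg_left (mul_le_mul_of_nonneg_left (hkb i hbb) (sub_nonneg.mpr (hφ1 i))) (hw i)

/-- **The atoms of a two-step member satisfy `Bounds`** (FKG on `γ` and `α` blockwise, FKG on `β`, signs). [this work] -/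
theorem bounds_atomsOf [DistribLattice α] [DistribLattice β] [DistribLattice γ]
    (hA : IsFKGMeasure wA) (hB : IsFKGMeasure wB) (hC : IsFKGMeasure wC)
    (hφ0 : ∀ c, 0 ≤ φ₁ c) (hφle : ∀ c, φ₁ c ≤ φ₂ c) (hφ1 : ∀ c, φ₂ c ≤ 1) (hφ1m : Monotone φ₁) (hφ2m : Monotone φ₂)
    (hψ0 : ∀ a, 0 ≤ ψ₂ a) (hψle : ∀ a, ψ₂ a ≤ ψ₁ a) (hψ1 : ∀ a, ψ₁ a ≤ 1) (hψ1m : Monotone ψ₁) (hψ2m : Monotone ψ₂)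
    (hg0 : ∀ c b, 0 ≤ g c b) (hgb : ∀ c, Monotone (g c)) (hgc : ∀ b, Monotone (fun c => g c b))
    (hh0 : ∀ a b, 0 ≤ h a b) (hha : ∀ b, Monotone (fun a => h a b)) (hhb : ∀ a, Monotone (h a)) :
    (atomsOf wA wB wC φ₁ φ₂ ψ₁ ψ₂ g h).Bounds := by
  have hA1 := hA.sum_eq_one; have hC1 := hC.sum_eq_one; have hB0 := hB.nonneg
  have hφ20 : ∀ c, 0 ≤ φ₂ c := fun c => (hφ0 c).trans (hφle c)
  have hψ10 : ∀ a, 0 ≤ ψ₁ a := fun a => (hψ0 a).trans (hψle a)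
  have m0 : ∀ b, 0 ≤ mB wC φ₁ g b := mB_nonneg hC.nonneg hφ0 hg0
  have d0 : ∀ b, 0 ≤ dB wC φ₁ φ₂ g b := dB_nonneg hC.nonneg hφle hg0
  have n0 : ∀ b, 0 ≤ nB wC φ₂ g b := nB_nonneg hC.nonneg hφ1 hg0
  have u0 : ∀ b, 0 ≤ mB wA ψ₂ h b := mB_nonneg hA.nonneg hψ0 hh0
  have e0 : ∀ b, 0 ≤ dB wA ψ₂ ψ₁ h b := dB_nonneg hA.nonneg hψle hh0
  have t0 : ∀ b, 0 ≤ nB wA ψ₁ h b := nB_nonneg hA.nonneg hψ1 hh0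
  have mm : Monotone (mB wC φ₁ g) := mB_mono hC.nonneg hφ0 hgb
  have dm : Monotone (dB wC φ₁ φ₂ g) := dB_mono hC.nonneg hφle hgb
  have nm : Monotone (nB wC φ₂ g) := nB_mono' hC.nonneg hφ1 hgb
  have um : Monotone (mB wA ψ₂ h) := mB_mono hA.nonneg hψ0 hhb
  have em : Monotone (dB wA ψ₂ ψ₁ h) := dB_mono hA.nonneg hψle hhb
  have tm : Monotone (nB wA ψ₁ h) := nB_mono' hA.nonneg hψ1 hhb
  have gsplit : ∀ b, (∑ c, wC c * g c b) = mB wC φ₁ g b + dB wC φ₁ φ₂ g b + nB wC φ₂ g b := fun b => by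
    simp only [mB, dB, nB, ← sum_add_distrib]; exact sum_congr rfl fun c _ => by ring
  have g2split : ∀ b, (∑ c, wC c * (φ₂ c * g c b)) = mB wC φ₁ g b + dB wC φ₁ φ₂ g b := fun b => by
    simp only [mB, dB, ← sum_add_distrib]; exact sum_congr rfl fun c _ => by ring
  have hsplit : ∀ b, (∑ a, wA a * h a b) = mB wA ψ₂ h b + dB wA ψ₂ ψ₁ h b + nB wA ψ₁ h b := fun b => by
    simp only [mB, dB, nB, ← sum_add_distrib]; exact sum_congr rfl fun a _ => by ring
  have h1 : ∀ b, (∑ a, wA a * (ψ₁ a * h a b)) = mB wA ψ₂ h b + dB wA ψ₂ ψ₁ h b := fun b => by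
    simp only [mB, dB, ← sum_add_distrib]; exact sum_congr rfl fun a _ => by ring
  -- blockwise FKG slacks
  have A1s : ∀ b, PC wC φ₁ * (mB wC φ₁ g b + dB wC φ₁ φ₂ g b + nB wC φ₂ g b) ≤ mB wC φ₁ g b := fun b => by
    have := slackC_nonneg (β := β) hC hφ0 hφ1m hg0 hgc b; rwa [gsplit b] at this
  have A2s : ∀ b, PC wC φ₂ * (mB wC φ₁ g b + dB wC φ₁ φ₂ g b + nB wC φ₂ g b) ≤ mB wC φ₁ g b + dB wC φ₁ φ₂ g b :=
    fun b => by have := slackC_nonneg (β := β) hC hφ20 hφ2m hg0 hgc b; rwa [gsplit b, g2split b] at this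
  have C1s : ∀ b, PC wA ψ₁ * (mB wA ψ₂ h b + dB wA ψ₂ ψ₁ h b + nB wA ψ₁ h b) ≤ mB wA ψ₂ h b + dB wA ψ₂ ψ₁ h b :=
    fun b => by have := slackC_nonneg (β := β) hA hψ10 hψ1m hh0 hha b; rwa [hsplit b, h1 b] at this
  have C2s : ∀ b, PC wA ψ₂ * (mB wA ψ₂ h b + dB wA ψ₂ ψ₁ h b + nB wA ψ₁ h b) ≤ mB wA ψ₂ h b := fun b => by
    have := slackC_nonneg (β := β) hA hψ0 hψ2m hh0 hha b; rwa [hsplit b] at this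
  have integ : ∀ F : β → ℝ, (∀ b, 0 ≤ F b) → 0 ≤ ∑ b, wB b * F b := fun F hF => sum_nonneg fun b _ => mul_nonneg (hB0 b) (hF b)
  exact {
    hP1 := PC_nonneg hC.nonneg hφ0
    hP12 := PC_mono hC.nonneg hφle
    hP2 := PC_le_one hC.nonneg hC1 hφ1
    hQ2 := PC_nonneg hA.nonneg hψ0
    hQ21 := PC_mono hA.nonneg hψle
    hQ1 := PC_le_one hA.nonneg hA1 hψ1
    smu := integ _ fun b => mul_nonneg (m0 b) (u0 b)
    sme := integ _ fun b => mul_nonneg (m0 b) (e0 b)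
    smt := integ _ fun b => mul_nonneg (m0 b) (t0 b)
    sdu := integ _ fun b => mul_nonneg (d0 b) (u0 b)
    sde := integ _ fun b => mul_nonneg (d0 b) (e0 b)
    sdt := integ _ fun b => mul_nonneg (d0 b) (t0 b)
    snu := integ _ fun b => mul_nonneg (n0 b) (u0 b)
    sne := integ _ fun b => mul_nonneg (n0 b) (e0 b)
    snt := integ _ fun b => mul_nonneg (n0 b) (t0 b)
    sm := integ _ (m0)
    sd := integ _ (d0)
    sn := integ _ (n0)
    su := integ _ (u0)
    se := integ _ (e0)
    st := integ _ (t0)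
    cmu := fkg_sum hB m0 u0 mm um
    cme := fkg_sum hB m0 e0 mm em
    cmt := fkg_sum hB m0 t0 mm tm
    cdu := fkg_sum hB d0 u0 dm um
    cde := fkg_sum hB d0 e0 dm em
    cdt := fkg_sum hB d0 t0 dm tm
    cnu := fkg_sum hB n0 u0 nm um
    cne := fkg_sum hB n0 e0 nm em
    cnt := fkg_sum hB n0 t0 nm tm
    a1u := by
      refine (integ (fun b => (mB wC φ₁ g b - PC wC φ₁ * (mB wC φ₁ g b + dB wC φ₁ φ₂ g b + nB wC φ₂ g b)) * mB wA ψ₂ h b) fun b => mul_nonneg (by linarith [A1s b]) (u0 b)).trans_eq ?_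
      simp only [atomsOf, Atoms.EA1u, mul_add, add_mul, mul_sub, sub_mul, mul_sum, ← sum_add_distrib, ← sum_sub_distrib]
      exact sum_congr rfl fun b _ => by ring
    a1e := by
      refine (integ (fun b => (mB wC φ₁ g b - PC wC φ₁ * (mB wC φ₁ g b + dB wC φ₁ φ₂ g b + nB wC φ₂ g b)) * dB wA ψ₂ ψ₁ h b) fun b => mul_nonneg (by linarith [A1s b]) (e0 b)).trans_eq ?_
      simp only [atomsOf, Atoms.EA1e, mul_add, add_mul, mul_sub, sub_mul, mul_sum, ← sum_add_distrib, ← sum_sub_distrib]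
      exact sum_congr rfl fun b _ => by ring
    a1t := by
      refine (integ (fun b => (mB wC φ₁ g b - PC wC φ₁ * (mB wC φ₁ g b + dB wC φ₁ φ₂ g b + nB wC φ₂ g b)) * nB wA ψ₁ h b) fun b => mul_nonneg (by linarith [A1s b]) (t0 b)).trans_eq ?_
      simp only [atomsOf, Atoms.EA1t, mul_add, add_mul, mul_sub, sub_mul, mul_sum, ← sum_add_distrib, ← sum_sub_distrib]
      exact sum_congr rfl fun b _ => by ring
    a2u := by
      refine (integ (fun b => (mB wC φ₁ g b + dB wC φ₁ φ₂ g b - PC wC φ₂ * (mB wC φ₁ g b + dB wC φ₁ φ₂ g b + nB wC φ₂ g b)) * mB wA ψ₂ h b) fun b => mul_nonneg (by linarith [A2s b]) (u0 b)).trans_eq ?_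
      simp only [atomsOf, Atoms.EA2u, mul_add, add_mul, mul_sub, sub_mul, mul_sum, ← sum_add_distrib, ← sum_sub_distrib]
      exact sum_congr rfl fun b _ => by ring
    a2e := by
      refine (integ (fun b => (mB wC φ₁ g b + dB wC φ₁ φ₂ g b - PC wC φ₂ * (mB wC φ₁ g b + dB wC φ₁ φ₂ g b + nB wC φ₂ g b)) * dB wA ψ₂ ψ₁ h b) fun b => mul_nonneg (by linarith [A2s b]) (e0 b)).trans_eq ?_
      simp only [atomsOf, Atoms.EA2e, mul_add, add_mul, mul_sub, sub_mul, mul_sum, ← sum_add_distrib, ← sum_sub_distrib]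
      exact sum_congr rfl fun b _ => by ring
    a2t := by
      refine (integ (fun b => (mB wC φ₁ g b + dB wC φ₁ φ₂ g b - PC wC φ₂ * (mB wC φ₁ g b + dB wC φ₁ φ₂ g b + nB wC φ₂ g b)) * nB wA ψ₁ h b) fun b => mul_nonneg (by linarith [A2s b]) (t0 b)).trans_eq ?_
      simp only [atomsOf, Atoms.EA2t, mul_add, add_mul, mul_sub, sub_mul, mul_sum, ← sum_add_distrib, ← sum_sub_distrib]
      exact sum_congr rfl fun b _ => by ring
    c1m := by
      refine (integ (fun b => mB wC φ₁ g b * (mB wA ψ₂ h b + dB wA ψ₂ ψ₁ h b - PC wA ψ₁ * (mB wA ψ₂ h b + dB wA ψ₂ ψ₁ h b + nB wA ψ₁ h b))) fun b => mul_nonneg (m0 b) (by linarith [C1s b])).trans_eq ?_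
      simp only [atomsOf, Atoms.EmC1, mul_add, mul_sub, sub_mul, mul_sum, ← sum_add_distrib, ← sum_sub_distrib]
      exact sum_congr rfl fun b _ => by ring
    c1d := by
      refine (integ (fun b => dB wC φ₁ φ₂ g b * (mB wA ψ₂ h b + dB wA ψ₂ ψ₁ h b - PC wA ψ₁ * (mB wA ψ₂ h b + dB wA ψ₂ ψ₁ h b + nB wA ψ₁ h b))) fun b => mul_nonneg (d0 b) (by linarith [C1s b])).trans_eq ?_
      simp only [atomsOf, Atoms.EdC1, mul_add, mul_sub, sub_mul, mul_sum, ← sum_add_distrib, ← sum_sub_distrib]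
      exact sum_congr rfl fun b _ => by ring
    c1n := by
      refine (integ (fun b => nB wC φ₂ g b * (mB wA ψ₂ h b + dB wA ψ₂ ψ₁ h b - PC wA ψ₁ * (mB wA ψ₂ h b + dB wA ψ₂ ψ₁ h b + nB wA ψ₁ h b))) fun b => mul_nonneg (n0 b) (by linarith [C1s b])).trans_eq ?_
      simp only [atomsOf, Atoms.EnC1, mul_add, mul_sub, sub_mul, mul_sum, ← sum_add_distrib, ← sum_sub_distrib]
      exact sum_congr rfl fun b _ => by ring
    c2m := by
      refine (integ (fun b => mB wC φ₁ g b * (mB wA ψ₂ h b - PC wA ψ₂ * (mB wA ψ₂ h b + dB wA ψ₂ ψ₁ h b + nB wA ψ₁ h b))) fun b => mul_nonneg (m0 b) (by linarith [C2s b])).trans_eq ?_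
      simp only [atomsOf, Atoms.EmC2, mul_add, mul_sub, sub_mul, mul_sum, ← sum_add_distrib, ← sum_sub_distrib]
      exact sum_congr rfl fun b _ => by ring
    c2d := by
      refine (integ (fun b => dB wC φ₁ φ₂ g b * (mB wA ψ₂ h b - PC wA ψ₂ * (mB wA ψ₂ h b + dB wA ψ₂ ψ₁ h b + nB wA ψ₁ h b))) fun b => mul_nonneg (d0 b) (by linarith [C2s b])).trans_eq ?_
      simp only [atomsOf, Atoms.EdC2, mul_add, mul_sub, sub_mul, mul_sum, ← sum_add_distrib, ← sum_sub_distrib]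
      exact sum_congr rfl fun b _ => by ring
    c2n := by
      refine (integ (fun b => nB wC φ₂ g b * (mB wA ψ₂ h b - PC wA ψ₂ * (mB wA ψ₂ h b + dB wA ψ₂ ψ₁ h b + nB wA ψ₁ h b))) fun b => mul_nonneg (n0 b) (by linarith [C2s b])).trans_eq ?_
      simp only [atomsOf, Atoms.EnC2, mul_add, mul_sub, sub_mul, mul_sum, ← sum_add_distrib, ← sum_sub_distrib]
      exact sum_congr rfl fun b _ => by ring
    a1c1 := by
      refine (integ (fun b => (mB wC φ₁ g b - PC wC φ₁ * (mB wC φ₁ g b + dB wC φ₁ φ₂ g b + nB wC φ₂ g b)) * (mB wA ψ₂ h b + dB wA ψ₂ ψ₁ h b - PC wA ψ₁ * (mB wA ψ₂ h b + dB wA ψ₂ ψ₁ h b + nB wA ψ₁ h b))) fun b => mul_nonneg (by linarith [A1s b]) (by linarith [C1s b])).trans_eq ?_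
      simp only [atomsOf, Atoms.EA1C1, mul_add, add_mul, mul_sub, sub_mul, mul_sum, ← sum_add_distrib, ← sum_sub_distrib]
      exact sum_congr rfl fun b _ => by ring
    a1c2 := by
      refine (integ (fun b => (mB wC φ₁ g b - PC wC φ₁ * (mB wC φ₁ g b + dB wC φ₁ φ₂ g b + nB wC φ₂ g b)) * (mB wA ψ₂ h b - PC wA ψ₂ * (mB wA ψ₂ h b + dB wA ψ₂ ψ₁ h b + nB wA ψ₁ h b))) fun b => mul_nonneg (by linarith [A1s b]) (by linarith [C2s b])).trans_eq ?_
      simp only [atomsOf, Atoms.EA1C2, mul_add, add_mul, mul_sub, sub_mul, mul_sum, ← sum_add_distrib, ← sum_sub_distrib]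
      exact sum_congr rfl fun b _ => by ring
    a2c1 := by
      refine (integ (fun b => (mB wC φ₁ g b + dB wC φ₁ φ₂ g b - PC wC φ₂ * (mB wC φ₁ g b + dB wC φ₁ φ₂ g b + nB wC φ₂ g b)) * (mB wA ψ₂ h b + dB wA ψ₂ ψ₁ h b - PC wA ψ₁ * (mB wA ψ₂ h b + dB wA ψ₂ ψ₁ h b + nB wA ψ₁ h b))) fun b => mul_nonneg (by linarith [A2s b]) (by linarith [C1s b])).trans_eq ?_
      simp only [atomsOf, Atoms.EA2C1, mul_add, add_mul, mul_sub, sub_mul, mul_sum, ← sum_add_distrib, ← sum_sub_distrib]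
      exact sum_congr rfl fun b _ => by ring
    a2c2 := by
      refine (integ (fun b => (mB wC φ₁ g b + dB wC φ₁ φ₂ g b - PC wC φ₂ * (mB wC φ₁ g b + dB wC φ₁ φ₂ g b + nB wC φ₂ g b)) * (mB wA ψ₂ h b - PC wA ψ₂ * (mB wA ψ₂ h b + dB wA ψ₂ ψ₁ h b + nB wA ψ₁ h b))) fun b => mul_nonneg (by linarith [A2s b]) (by linarith [C2s b])).trans_eq ?_
      simp only [atomsOf, Atoms.EA2C2, mul_add, add_mul, mul_sub, sub_mul, mul_sum, ← sum_add_distrib, ← sum_sub_distrib]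
      exact sum_congr rfl fun b _ => by ring
    ea1 := by
      refine (integ (fun b => (mB wC φ₁ g b - PC wC φ₁ * (mB wC φ₁ g b + dB wC φ₁ φ₂ g b + nB wC φ₂ g b))) fun b => by linarith [A1s b]).trans_eq ?_
      simp only [atomsOf, Atoms.EA1, mul_add, mul_sub, sub_mul, mul_sum, ← sum_add_distrib, ← sum_sub_distrib]
      exact sum_congr rfl fun b _ => by ring
    ea2 := by
      refine (integ (fun b => (mB wC φ₁ g b + dB wC φ₁ φ₂ g b - PC wC φ₂ * (mB wC φ₁ g b + dB wC φ₁ φ₂ g b + nB wC φ₂ g b))) fun b => by linarith [A2s b]).trans_eq ?_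
      simp only [atomsOf, Atoms.EA2, mul_add, mul_sub, sub_mul, mul_sum, ← sum_add_distrib, ← sum_sub_distrib]
      exact sum_congr rfl fun b _ => by ring
    ec1 := by
      refine (integ (fun b => (mB wA ψ₂ h b + dB wA ψ₂ ψ₁ h b - PC wA ψ₁ * (mB wA ψ₂ h b + dB wA ψ₂ ψ₁ h b + nB wA ψ₁ h b))) fun b => by linarith [C1s b]).trans_eq ?_
      simp only [atomsOf, Atoms.EC1, mul_add, mul_sub, sub_mul, mul_sum, ← sum_add_distrib, ← sum_sub_distrib]
      exact sum_congr rfl fun b _ => by ring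
    ec2 := by
      refine (integ (fun b => (mB wA ψ₂ h b - PC wA ψ₂ * (mB wA ψ₂ h b + dB wA ψ₂ ψ₁ h b + nB wA ψ₁ h b))) fun b => by linarith [C2s b]).trans_eq ?_
      simp only [atomsOf, Atoms.EC2, mul_add, mul_sub, sub_mul, mul_sum, ← sum_add_distrib, ← sum_sub_distrib]
      exact sum_congr rfl fun b _ => by ring
  }

variable (wA wB wC φ₁ φ₂ ψ₁ ψ₂ g h)

/-- **THEOREM (triangle with a GENERAL two-step staircase member, mass condition).**  `α, β, γ` finite distributive lattices with FKG
probability weights; `g, h ≥ 0` coordinatewise monotone; `0 ≤ φ₁ ≤ φ₂ ≤ 1` monotone on `γ`, `0 ≤ ψ₂ ≤ ψ₁ ≤ 1` monotone on `α`,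
`f = φ₁⊗ψ₁ + (φ₂−φ₁)⊗ψ₂` (events: `(U₁×V₁) ∪ (U₂×V₂)`, `U₁ ⊆ U₂`, `V₁ ⊇ V₂` increasing).  If `E φ₁, E ψ₂ > 0` and
`min(E φ₁, E ψ₂) ≤ E φ₁·E ψ₁ + E φ₂·E ψ₂` (e.g. `E φ₂ ≥ 1/2 ∧ E ψ₁ ≥ 1/2`, or `φ₂ ≡ 1`, or `ψ₁ ≡ 1`), then Sahi's `E_3(f,g,h) ≥ 0`.
Proof: `sahiE_three_eq_E3`, `bounds_atomsOf`, `Atoms.E3_nonneg_of_min_le`. [this work] -/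
theorem sahiE_three_nonneg_of_staircaseTwo_of_min_le [DistribLattice α] [DistribLattice β] [DistribLattice γ]
    (hA : IsFKGMeasure wA) (hB : IsFKGMeasure wB) (hC : IsFKGMeasure wC)
    (hφ0 : ∀ c, 0 ≤ φ₁ c) (hφle : ∀ c, φ₁ c ≤ φ₂ c) (hφ1 : ∀ c, φ₂ c ≤ 1) (hφ1m : Monotone φ₁) (hφ2m : Monotone φ₂)
    (hψ0 : ∀ a, 0 ≤ ψ₂ a) (hψle : ∀ a, ψ₂ a ≤ ψ₁ a) (hψ1 : ∀ a, ψ₁ a ≤ 1) (hψ1m : Monotone ψ₁) (hψ2m : Monotone ψ₂)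
    (hg0 : ∀ c b, 0 ≤ g c b) (hgb : ∀ c, Monotone (g c)) (hgc : ∀ b, Monotone (fun c => g c b))
    (hh0 : ∀ a b, 0 ≤ h a b) (hha : ∀ b, Monotone (fun a => h a b)) (hhb : ∀ a, Monotone (h a))
    (hP1 : 0 < PC wC φ₁) (hQ2 : 0 < PC wA ψ₂)
    (hreg : min (PC wC φ₁) (PC wA ψ₂) ≤ PC wC φ₁ * PC wA ψ₁ + PC wC φ₂ * PC wA ψ₂) :
    0 ≤ sahiE (fun p : α × β × γ => wA p.1 * wB p.2.1 * wC p.2.2) 3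
        ![fun p => φ₁ p.2.2 * ψ₁ p.1 + (φ₂ p.2.2 - φ₁ p.2.2) * ψ₂ p.1, fun p => g p.2.2 p.2.1, fun p => h p.1 p.2.1] := by
  rw [sahiE_three_eq_E3 wA wB wC φ₁ φ₂ ψ₁ ψ₂ g h hA.sum_eq_one hB.sum_eq_one hC.sum_eq_one]
  exact Atoms.E3_nonneg_of_min_le
    (bounds_atomsOf hA hB hC hφ0 hφle hφ1 hφ1m hφ2m hψ0 hψle hψ1 hψ1m hψ2m hg0 hgb hgc hh0 hha hhb) hP1 hQ2 hreg

/-- **THEOREM (two-step staircase member, covariance-order cases).**  Same setting; if `Cov(φ₁,g) ≤ Cov(φ₂,g)` on `γ×β`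
(`E_b[A₁] ≤ E_b[A₂]`) or `Cov(ψ₂,h) ≤ Cov(ψ₁,h)` on `α×β` (`E_b[C₂] ≤ E_b[C₁]`), then `E_3(f,g,h) ≥ 0` — no mass condition.
Proof: `E_3 = T₁+T₂+T₃` (`Atoms.E3_eq_T`). [this work] -/
theorem sahiE_three_nonneg_of_staircaseTwo_of_cov_le [DistribLattice α] [DistribLattice β] [DistribLattice γ]
    (hA : IsFKGMeasure wA) (hB : IsFKGMeasure wB) (hC : IsFKGMeasure wC)
    (hφ0 : ∀ c, 0 ≤ φ₁ c) (hφle : ∀ c, φ₁ c ≤ φ₂ c) (hφ1 : ∀ c, φ₂ c ≤ 1) (hφ1m : Monotone φ₁) (hφ2m : Monotone φ₂)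
    (hψ0 : ∀ a, 0 ≤ ψ₂ a) (hψle : ∀ a, ψ₂ a ≤ ψ₁ a) (hψ1 : ∀ a, ψ₁ a ≤ 1) (hψ1m : Monotone ψ₁) (hψ2m : Monotone ψ₂)
    (hg0 : ∀ c b, 0 ≤ g c b) (hgb : ∀ c, Monotone (g c)) (hgc : ∀ b, Monotone (fun c => g c b))
    (hh0 : ∀ a b, 0 ≤ h a b) (hha : ∀ b, Monotone (fun a => h a b)) (hhb : ∀ a, Monotone (h a))
    (hcov : (atomsOf wA wB wC φ₁ φ₂ ψ₁ ψ₂ g h).EA1 ≤ (atomsOf wA wB wC φ₁ φ₂ ψ₁ ψ₂ g h).EA2 ∨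
      (atomsOf wA wB wC φ₁ φ₂ ψ₁ ψ₂ g h).EC2 ≤ (atomsOf wA wB wC φ₁ φ₂ ψ₁ ψ₂ g h).EC1) :
    0 ≤ sahiE (fun p : α × β × γ => wA p.1 * wB p.2.1 * wC p.2.2) 3
        ![fun p => φ₁ p.2.2 * ψ₁ p.1 + (φ₂ p.2.2 - φ₁ p.2.2) * ψ₂ p.1, fun p => g p.2.2 p.2.1, fun p => h p.1 p.2.1] := by
  rw [sahiE_three_eq_E3 wA wB wC φ₁ φ₂ ψ₁ ψ₂ g h hA.sum_eq_one hB.sum_eq_one hC.sum_eq_one]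
  have hb := bounds_atomsOf hA hB hC hφ0 hφle hφ1 hφ1m hφ2m hψ0 hψle hψ1 hψ1m hψ2m hg0 hgb hgc hh0 hha hhb
  rcases hcov with hcv | hcv
  · exact Atoms.E3_nonneg_of_EA_le hb hcv
  · exact Atoms.E3_nonneg_of_EC_le hb hcv

end Member

end SahiTriangleStaircaseTwo

end Summit.CriticalPhenomena.PercolationContinuityZ3.Theorems

end
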